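import Mathlib

/-!
# Crux `AnchorGap` (stmt-QuantumFields-11141), line `registered` — lattice theta sums I (soft layer under stub DSred)

Stub DSred (`stub_debyeScreening`, reduced form) of the skeleton `Cruxes/AnchorGap/Lines/birth.lean`
is Debye screening of the `k`-component lattice sine-Gordon gas on the discrete three-torus with the
regulator `ε` removed before the volume limit (`∃ ε₀(N)` after `∀ N`).  The soft fixed-`N` step of
its proof folds the regulated measure over the lattice `Λ' = Σ_j ℤ b_j` of constant field shifts
(`b` the commensurate basis of the charge-lattice dual): the zero mode `θ̄` (volume average of the
field) then carries, on a fundamental cell of `Λ'`, exactly the prior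

  `Θ_a(θ̄) = Σ_{n ∈ ℤᵏ} exp(−(a/2) |θ̄ + Σ_j n_j b_j|²)`,   `a = ε N^d / g²`,

and the fixed-`N` limit `ε → 0` is the statement that this prior becomes flat.  This file and its
sequel (`…StubDebyeScreening7.lean`) prove that flatness by elementary means (no Poisson summation):

* `latticeTheta_summable`, `latticeTheta_pos` — convergence and positivity of `Θ_a(θ)`;
* `latticeTheta_doubling` — `Σ_n e^{−(s/4)Q(n)} ≤ 2ᵏ e^{sB/4} Σ_n e^{−(s/2)Q(n)}` for the lattice
  form `Q(n) = |Σ_j n_j b_j|²`, `B = Σ_c (Σ_j |b_j c|)²` (split `n = 2m + r`, `r ∈ {0,1}ᵏ`);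
* `latticeTheta_shift` — `(1 − 2ᵏ e^{sB/4} e^{−sK/4}) Σ e^{−(s/2)Q} ≤ e^{tK/2} Σ e^{−((s+t)/2)Q}`
  (split the sum at `Q ≤ K`, control the tail by the doubling bound): the centred theta sum changes
  by a factor `1 + o(1)` under `s ↦ s(1 + η)`, uniformly as `s → 0`, which is the engine of
  `latticeTheta_flat` in the sequel.
-/

set_option autoImplicit false

noncomputable section

namespace Summit.QuantumFields.YangMills.Theorems.AnchorGap

open MeasureTheory Finset

/-- **The lattice theta sum converges.** For a linearly independent family `b` (a basis of `ℝᵏ`),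
`a > 0` and any centre `θ`, `n ↦ exp(−(a/2)|θ + Σ_j n_j b_j|²)` is summable over `ℤᵏ`
(comparison with `‖z‖^{-2(k+1)}` over the lattice `Σ_j ℤ b_j`, `ZLattice.summable_norm_pow_inv`,
using `|θ + z|² ≥ |z|²/2 − |θ|²` and `e^{-x} ≤ m!/x^m`). [folklore] -/
theorem latticeTheta_summable :
    ∀ (k : ℕ) (b : Fin k → Fin k → ℝ), LinearIndependent ℝ b → ∀ (a : ℝ), 0 < a → ∀ θ : Fin k → ℝ, Summable (fun n : Fin k → ℤ => Real.exp (-(a / 2) * ∑ c : Fin k, (θ c + ∑ j : Fin k, (n j : ℝ) * b j c) ^ 2)) := by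
  intro k b hb a ha θ
  classical
  -- the lattice `L = Σ_j ℤ b_j` and its parametrisation by `ℤᵏ`
  let B := basisOfPiSpaceOfLinearIndependent hb
  have hB : ⇑B = b := coe_basisOfPiSpaceOfLinearIndependent hb
  let L : Submodule ℤ (Fin k → ℝ) := Submodule.span ℤ (Set.range B)
  let e : (Fin k → ℤ) ≃ L := (B.restrictScalars ℤ).equivFun.symm.toEquiv
  have he : ∀ n : Fin k → ℤ, ((e n : L) : Fin k → ℝ) = fun c => ∑ j, (n j : ℝ) * b j c := by
    intro n
    simp only [e, LinearEquiv.coe_toEquiv, Module.Basis.equivFun_symm_apply]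
    rw [Submodule.coe_sum]
    funext c
    simp [Module.Basis.restrictScalars_apply, ← hB, zsmul_eq_mul, Finset.sum_apply]
  have hfr : Module.finrank ℤ L < 2 * (k + 1) := by
    have := finrank_range_le_card (R := ℤ) (⇑B)
    simp only [Set.finrank, Fintype.card_fin] at this
    show Module.finrank ℤ (Submodule.span ℤ (Set.range ⇑B)) < 2 * (k + 1)
    omega
  have hs := ZLattice.summable_norm_pow_inv L (2 * (k + 1)) hfr
  -- transfer the summability question to the lattice
  refine (e.symm.summable_iff).1 ?_
  set K : ℝ := Real.exp (a / 2 * ∑ c, θ c ^ 2) * ((k + 1).factorial * (4 / a) ^ (k + 1)) with hK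
  refine Summable.of_norm_bounded_eventually (g := fun z : L => K * (‖z‖⁻¹) ^ (2 * (k + 1)))
    (hs.mul_left K) ?_
  -- the bound holds off the origin
  refine Filter.eventually_cofinite.2 ((Set.finite_singleton (0 : L)).subset ?_)
  intro z hz
  simp only [Set.mem_setOf_eq, not_le] at hz
  simp only [Set.mem_singleton_iff]
  by_contra hz0
  refine absurd hz (not_lt.2 ?_)
  have hez : (fun c => ∑ j, ((e.symm z : Fin k → ℤ) j : ℝ) * b j c) = ((z : L) : Fin k → ℝ) := by
    rw [← he, Equiv.apply_symm_apply]
  simp only [Function.comp_apply, Real.norm_eq_abs, abs_of_pos (Real.exp_pos _)]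
  have hsum : ∀ c, ∑ j, ((e.symm z : Fin k → ℤ) j : ℝ) * b j c = (z : Fin k → ℝ) c := fun c =>
    congrFun hez c
  simp only [hsum]
  -- `t = |z|²` (Euclidean) controls the sup norm: `‖z‖² ≤ t`, and `t > 0` off the origin
  set t : ℝ := ∑ c, ((z : Fin k → ℝ) c) ^ 2 with ht
  have ht0 : 0 ≤ t := sum_nonneg fun c _ => sq_nonneg _
  have hnorm_le : ‖z‖ ≤ Real.sqrt t := by
    rw [← Submodule.norm_coe, pi_norm_le_iff_of_nonneg (Real.sqrt_nonneg _)]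
    intro c
    rw [Real.norm_eq_abs]
    exact Real.abs_le_sqrt (single_le_sum (f := fun c => ((z : Fin k → ℝ) c) ^ 2)
      (fun c _ => sq_nonneg _) (mem_univ c))
  have hnorm_pos : 0 < ‖z‖ := norm_pos_iff.2 hz0
  have hsq : ‖z‖ ^ 2 ≤ t := by
    calc ‖z‖ ^ 2 ≤ (Real.sqrt t) ^ 2 := by gcongr
      _ = t := Real.sq_sqrt ht0
  have htpos : 0 < t := lt_of_lt_of_le (by positivity) hsq
  -- `|θ + z|² ≥ t/2 − |θ|²`
  have hlow : t / 2 - ∑ c, θ c ^ 2 ≤ ∑ c, (θ c + (z : Fin k → ℝ) c) ^ 2 := by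
    have : ∀ c, ((z : Fin k → ℝ) c) ^ 2 / 2 - θ c ^ 2 ≤ (θ c + (z : Fin k → ℝ) c) ^ 2 := by
      intro c
      nlinarith [sq_nonneg (2 * θ c + (z : Fin k → ℝ) c)]
    calc t / 2 - ∑ c, θ c ^ 2 = ∑ c, (((z : Fin k → ℝ) c) ^ 2 / 2 - θ c ^ 2) := by
          rw [sum_sub_distrib, ← sum_div]
      _ ≤ _ := sum_le_sum fun c _ => this c
  -- `exp(−(a/4) t) ≤ (k+1)! / ((a/4) t)^{k+1}`
  have hx : 0 < a / 4 * t := by positivity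
  have hexp : Real.exp (-(a / 4 * t)) ≤ (k + 1).factorial / (a / 4 * t) ^ (k + 1) := by
    have h1 := Real.pow_div_factorial_le_exp (a / 4 * t) hx.le (k + 1)
    rw [Real.exp_neg, inv_eq_one_div, div_le_div_iff₀ (Real.exp_pos _) (by positivity), one_mul]
    rw [div_le_iff₀ (by positivity)] at h1
    linarith
  -- `1/t^{k+1} ≤ ‖z‖^{-2(k+1)}`
  have hpow : (t ^ (k + 1))⁻¹ ≤ (‖z‖⁻¹) ^ (2 * (k + 1)) := by
    rw [inv_pow, pow_mul]
    exact inv_anti₀ (by positivity) (pow_le_pow_left₀ (by positivity) hsq _)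
  calc Real.exp (-(a / 2) * ∑ c, (θ c + (z : Fin k → ℝ) c) ^ 2)
      ≤ Real.exp (a / 2 * ∑ c, θ c ^ 2 + -(a / 4 * t)) := by
        refine Real.exp_le_exp.2 ?_
        nlinarith [hlow, ha]
    _ = Real.exp (a / 2 * ∑ c, θ c ^ 2) * Real.exp (-(a / 4 * t)) := Real.exp_add _ _
    _ ≤ Real.exp (a / 2 * ∑ c, θ c ^ 2) * ((k + 1).factorial / (a / 4 * t) ^ (k + 1)) := by
        gcongr
    _ = K * (t ^ (k + 1))⁻¹ := by
        rw [hK, mul_pow, div_pow, div_pow]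
        field_simp
    _ ≤ K * (‖z‖⁻¹) ^ (2 * (k + 1)) := by
        refine mul_le_mul_of_nonneg_left hpow ?_
        rw [hK]; positivity


/-- **The lattice theta sum is positive** (all terms are positive, the `n = 0` term alone
gives `Θ_a(θ) > 0`). [folklore] -/
theorem latticeTheta_pos :
    ∀ (k : ℕ) (b : Fin k → Fin k → ℝ), LinearIndependent ℝ b → ∀ (a : ℝ), 0 < a → ∀ θ : Fin k → ℝ, 0 < ∑' n : Fin k → ℤ, Real.exp (-(a / 2) * ∑ c : Fin k, (θ c + ∑ j : Fin k, (n j : ℝ) * b j c) ^ 2) := by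
  intro k b hb a ha θ
  exact (latticeTheta_summable k b hb a ha θ).tsum_pos (fun n => (Real.exp_pos _).le) 0 (Real.exp_pos _)

/-- `2 Σ θ_c v_c ≤ η |v|² + η⁻¹ |θ|²` (complete the square). -/
private lemma two_inner_le {k : ℕ} (η : ℝ) (hη : 0 < η) (θ v : Fin k → ℝ) :
    2 * ∑ c, θ c * v c ≤ η * ∑ c, v c ^ 2 + η⁻¹ * ∑ c, θ c ^ 2 := by
  have h0 : 0 ≤ ∑ c, η⁻¹ * (η * v c - θ c) ^ 2 := sum_nonneg fun c _ => by positivity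
  have hexp : ∑ c, η⁻¹ * (η * v c - θ c) ^ 2 =
      η * ∑ c, v c ^ 2 + η⁻¹ * ∑ c, θ c ^ 2 - 2 * ∑ c, θ c * v c := by
    rw [mul_sum, mul_sum, mul_sum, ← sum_add_distrib, ← sum_sub_distrib]
    refine sum_congr rfl fun c _ => ?_
    field_simp
    ring
  linarith

/-- `2 |Σ θ_c v_c| ≤ η |v|² + η⁻¹ |θ|²` (Cauchy–Schwarz in arithmetic–geometric form). -/
private lemma two_abs_inner_le {k : ℕ} (η : ℝ) (hη : 0 < η) (θ v : Fin k → ℝ) :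
    2 * |∑ c, θ c * v c| ≤ η * ∑ c, v c ^ 2 + η⁻¹ * ∑ c, θ c ^ 2 := by
  have h1 := two_inner_le η hη θ v
  have h2 := two_inner_le η hη (fun c => -θ c) v
  simp only [neg_mul, sum_neg_distrib, mul_neg, neg_sq] at h2
  have : |∑ c, θ c * v c| ≤ (η * ∑ c, v c ^ 2 + η⁻¹ * ∑ c, θ c ^ 2) / 2 :=
    abs_le.2 ⟨by linarith, by linarith⟩
  linarith

/-- **Doubling bound**: `Σ_n e^{−(s/4) Q(n)} ≤ 2ᵏ e^{sB/4} Σ_n e^{−(s/2) Q(n)}` for the lattice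
quadratic form `Q(n) = |Σ_j n_j b_j|²`, `B = Σ_c (Σ_j |b_j c|)²` (split `n = 2m + r`, `r ∈ {0,1}ᵏ`,
and use `|2u + v|² ≥ 2|u|² − |v|²`). -/
theorem latticeTheta_doubling :
    ∀ (k : ℕ) (b : Fin k → Fin k → ℝ), LinearIndependent ℝ b → ∀ (s : ℝ), 0 < s → ∑' n : Fin k → ℤ, Real.exp (-(s / 4) * ∑ c : Fin k, (∑ j : Fin k, (n j : ℝ) * b j c) ^ 2) ≤ 2 ^ k * Real.exp (s / 4 * ∑ c : Fin k, (∑ j : Fin k, |b j c|) ^ 2) * ∑' n : Fin k → ℤ, Real.exp (-(s / 2) * ∑ c : Fin k, (∑ j : Fin k, (n j : ℝ) * b j c) ^ 2) := by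
  intro k b hb s hs
  classical
  set Q : (Fin k → ℤ) → ℝ := fun n => ∑ c, (∑ j, (n j : ℝ) * b j c) ^ 2 with hQ
  set Bc : ℝ := ∑ c, (∑ j, |b j c|) ^ 2 with hBc
  have hsum : ∀ u : ℝ, 0 < u → Summable fun n : Fin k → ℤ => Real.exp (-(u / 2) * Q n) := by
    intro u hu
    simpa [hQ] using latticeTheta_summable k b hb u hu 0
  have hs4 : Summable fun n : Fin k → ℤ => Real.exp (-(s / 4) * Q n) := by
    have := hsum (s / 2) (by positivity)
    convert this using 3
    ring
  -- the splitting bijection `(m, r) ↦ 2m + r`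
  let E2 : (Fin k → ℤ) × (Fin k → Fin 2) ≃ (Fin k → ℤ) :=
    (Equiv.arrowProdEquivProdArrow _ _ _).symm.trans
      (Equiv.piCongrRight fun _ : Fin k => (Int.divModEquiv 2).symm)
  have hE2 : ∀ (m : Fin k → ℤ) (r : Fin k → Fin 2) (j : Fin k),
      E2 (m, r) j = m j * 2 + ((r j : ℕ) : ℤ) := fun m r j => rfl
  -- key algebra: `Q(2m + r) ≥ 2 Q(m) − B`
  have hkey : ∀ (m : Fin k → ℤ) (r : Fin k → Fin 2), 2 * Q m - Bc ≤ Q (E2 (m, r)) := by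
    intro m r
    have hcoord : ∀ c, ∑ j, ((E2 (m, r) j : ℤ) : ℝ) * b j c =
        2 * (∑ j, (m j : ℝ) * b j c) + ∑ j, ((r j : ℕ) : ℝ) * b j c := by
      intro c
      rw [mul_sum, ← sum_add_distrib]
      refine sum_congr rfl fun j _ => ?_
      rw [hE2]
      push_cast
      ring
    have hv : ∀ c, (∑ j, ((r j : ℕ) : ℝ) * b j c) ^ 2 ≤ (∑ j, |b j c|) ^ 2 := by
      intro c
      have habs : |∑ j, ((r j : ℕ) : ℝ) * b j c| ≤ ∑ j, |b j c| := by
        refine (abs_sum_le_sum_abs _ _).trans (sum_le_sum fun j _ => ?_)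
        rw [abs_mul]
        have hr : ((r j : ℕ) : ℝ) ≤ 1 := by
          have := (r j).is_lt
          exact_mod_cast Nat.lt_succ_iff.1 this
        have hr0 : 0 ≤ ((r j : ℕ) : ℝ) := by positivity
        rw [abs_of_nonneg hr0]
        exact mul_le_of_le_one_left (abs_nonneg _) hr
      calc (∑ j, ((r j : ℕ) : ℝ) * b j c) ^ 2 = |∑ j, ((r j : ℕ) : ℝ) * b j c| ^ 2 := (sq_abs _).symm
        _ ≤ (∑ j, |b j c|) ^ 2 := pow_le_pow_left₀ (abs_nonneg _) habs 2
    have hterm : ∀ c, 2 * (∑ j, (m j : ℝ) * b j c) ^ 2 - (∑ j, |b j c|) ^ 2 ≤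
        (∑ j, ((E2 (m, r) j : ℤ) : ℝ) * b j c) ^ 2 := by
      intro c
      rw [hcoord c]
      nlinarith [hv c, sq_nonneg (∑ j, (m j : ℝ) * b j c + ∑ j, ((r j : ℕ) : ℝ) * b j c)]
    calc 2 * Q m - Bc = ∑ c, (2 * (∑ j, (m j : ℝ) * b j c) ^ 2 - (∑ j, |b j c|) ^ 2) := by
          rw [hQ, hBc, sum_sub_distrib, mul_sum]
      _ ≤ Q (E2 (m, r)) := sum_le_sum fun c _ => hterm c
  -- termwise bound after reindexing
  have hpt : ∀ p : (Fin k → ℤ) × (Fin k → Fin 2),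
      Real.exp (-(s / 4) * Q (E2 p)) ≤ Real.exp (s / 4 * Bc) * Real.exp (-(s / 2) * Q p.1) := by
    rintro ⟨m, r⟩
    rw [← Real.exp_add]
    refine Real.exp_le_exp.2 ?_
    have := hkey m r
    nlinarith
  -- pass to `ℝ≥0∞`, where reindexing and Fubini are unconditional
  have hnn1 : ∀ n : Fin k → ℤ, 0 ≤ Real.exp (-(s / 4) * Q n) := fun n => (Real.exp_pos _).le
  have hnn2 : ∀ n : Fin k → ℤ, 0 ≤ Real.exp (-(s / 2) * Q n) := fun n => (Real.exp_pos _).le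
  have hcard : Fintype.card (Fin k → Fin 2) = 2 ^ k := by
    rw [Fintype.card_fun, Fintype.card_fin, Fintype.card_fin]
  have hC0 : 0 ≤ (2 : ℝ) ^ k * Real.exp (s / 4 * Bc) := by positivity
  have key : ENNReal.ofReal (∑' n : Fin k → ℤ, Real.exp (-(s / 4) * Q n)) ≤
      ENNReal.ofReal (2 ^ k * Real.exp (s / 4 * Bc) * ∑' n : Fin k → ℤ, Real.exp (-(s / 2) * Q n)) := by
    rw [ENNReal.ofReal_tsum_of_nonneg hnn1 hs4, ← E2.tsum_eq]
    calc ∑' p : (Fin k → ℤ) × (Fin k → Fin 2), ENNReal.ofReal (Real.exp (-(s / 4) * Q (E2 p)))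
        ≤ ∑' p : (Fin k → ℤ) × (Fin k → Fin 2),
            ENNReal.ofReal (Real.exp (s / 4 * Bc)) * ENNReal.ofReal (Real.exp (-(s / 2) * Q p.1)) := by
          refine ENNReal.tsum_le_tsum fun p => ?_
          rw [← ENNReal.ofReal_mul (Real.exp_pos _).le]
          exact ENNReal.ofReal_le_ofReal (hpt p)
      _ = ∑' (m : Fin k → ℤ) (r : Fin k → Fin 2),
            ENNReal.ofReal (Real.exp (s / 4 * Bc)) * ENNReal.ofReal (Real.exp (-(s / 2) * Q m)) :=
          ENNReal.tsum_prod'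
      _ = ∑' (m : Fin k → ℤ), (2 ^ k : ENNReal) *
            (ENNReal.ofReal (Real.exp (s / 4 * Bc)) * ENNReal.ofReal (Real.exp (-(s / 2) * Q m))) := by
          refine tsum_congr fun m => ?_
          rw [tsum_fintype, sum_const, card_univ, hcard, nsmul_eq_mul]
          push_cast
          ring
      _ = (2 ^ k : ENNReal) * (ENNReal.ofReal (Real.exp (s / 4 * Bc)) *
            ∑' (m : Fin k → ℤ), ENNReal.ofReal (Real.exp (-(s / 2) * Q m))) := by
          rw [ENNReal.tsum_mul_left, ENNReal.tsum_mul_left]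
      _ = ENNReal.ofReal (2 ^ k * Real.exp (s / 4 * Bc) * ∑' n : Fin k → ℤ, Real.exp (-(s / 2) * Q n)) := by
          rw [← ENNReal.ofReal_tsum_of_nonneg hnn2 (hsum s hs), ENNReal.ofReal_mul hC0,
            ENNReal.ofReal_mul (by positivity), ENNReal.ofReal_pow (by norm_num)]
          simp only [ENNReal.ofReal_ofNat]
          ring
  have hrhs : 0 ≤ 2 ^ k * Real.exp (s / 4 * Bc) * ∑' n : Fin k → ℤ, Real.exp (-(s / 2) * Q n) :=
    mul_nonneg hC0 (tsum_nonneg hnn2)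
  exact (ENNReal.ofReal_le_ofReal_iff hrhs).1 key

/-- **Shift of the theta parameter**: for `0 < s`, `0 ≤ t` and any `K`,
`(1 − 2ᵏ e^{sB/4} e^{−sK/4}) Σ e^{−(s/2)Q} ≤ e^{tK/2} Σ e^{−((s+t)/2)Q}` (split the sum at `Q ≤ K`
and control the tail by the doubling bound). -/
theorem latticeTheta_shift :
    ∀ (k : ℕ) (b : Fin k → Fin k → ℝ), LinearIndependent ℝ b → ∀ (s t K : ℝ), 0 < s → 0 ≤ t → (1 - 2 ^ k * Real.exp (s / 4 * ∑ c : Fin k, (∑ j : Fin k, |b j c|) ^ 2) * Real.exp (-(s / 4 * K))) * ∑' n : Fin k → ℤ, Real.exp (-(s / 2) * ∑ c : Fin k, (∑ j : Fin k, (n j : ℝ) * b j c) ^ 2) ≤ Real.exp (t / 2 * K) * ∑' n : Fin k → ℤ, Real.exp (-((s + t) / 2) * ∑ c : Fin k, (∑ j : Fin k, (n j : ℝ) * b j c) ^ 2) := by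
  intro k b hb s t K hs ht
  set Q : (Fin k → ℤ) → ℝ := fun n => ∑ c, (∑ j, (n j : ℝ) * b j c) ^ 2 with hQ
  set Bc : ℝ := ∑ c, (∑ j, |b j c|) ^ 2 with hBc
  have hsum : ∀ u : ℝ, 0 < u → Summable fun n : Fin k → ℤ => Real.exp (-(u / 2) * Q n) := by
    intro u hu
    simpa [hQ] using latticeTheta_summable k b hb u hu 0
  have hs4 : Summable fun n : Fin k → ℤ => Real.exp (-(s / 4) * Q n) := by
    have := hsum (s / 2) (by positivity)
    convert this using 3
    ring
  have hQ0 : ∀ n, 0 ≤ Q n := fun n => sum_nonneg fun c _ => sq_nonneg _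
  -- termwise split at `Q ≤ K`
  have hterm : ∀ n : Fin k → ℤ, Real.exp (-(s / 2) * Q n) ≤
      Real.exp (t / 2 * K) * Real.exp (-((s + t) / 2) * Q n) +
        Real.exp (-(s / 4 * K)) * Real.exp (-(s / 4) * Q n) := by
    intro n
    have hA : 0 ≤ Real.exp (t / 2 * K) * Real.exp (-((s + t) / 2) * Q n) := by positivity
    have hB : 0 ≤ Real.exp (-(s / 4 * K)) * Real.exp (-(s / 4) * Q n) := by positivity
    by_cases hQK : Q n ≤ K
    · have : Real.exp (-(s / 2) * Q n) ≤ Real.exp (t / 2 * K) * Real.exp (-((s + t) / 2) * Q n) := by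
        rw [← Real.exp_add]
        exact Real.exp_le_exp.2 (by nlinarith)
      linarith
    · have : Real.exp (-(s / 2) * Q n) ≤ Real.exp (-(s / 4 * K)) * Real.exp (-(s / 4) * Q n) := by
        rw [← Real.exp_add]
        exact Real.exp_le_exp.2 (by nlinarith [not_le.1 hQK])
      linarith
  have hS1 : Summable fun n : Fin k → ℤ => Real.exp (t / 2 * K) * Real.exp (-((s + t) / 2) * Q n) :=
    (hsum (s + t) (by linarith)).mul_left _
  have hS2 : Summable fun n : Fin k → ℤ => Real.exp (-(s / 4 * K)) * Real.exp (-(s / 4) * Q n) :=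
    hs4.mul_left _
  have hsplit : ∑' n : Fin k → ℤ, Real.exp (-(s / 2) * Q n) ≤
      Real.exp (t / 2 * K) * ∑' n : Fin k → ℤ, Real.exp (-((s + t) / 2) * Q n) +
        Real.exp (-(s / 4 * K)) * ∑' n : Fin k → ℤ, Real.exp (-(s / 4) * Q n) := by
    calc ∑' n : Fin k → ℤ, Real.exp (-(s / 2) * Q n)
        ≤ ∑' n : Fin k → ℤ, (Real.exp (t / 2 * K) * Real.exp (-((s + t) / 2) * Q n) +
            Real.exp (-(s / 4 * K)) * Real.exp (-(s / 4) * Q n)) :=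
          Summable.tsum_le_tsum hterm (hsum s hs) (hS1.add hS2)
      _ = _ := by rw [hS1.tsum_add hS2, tsum_mul_left, tsum_mul_left]
  have hdoub := latticeTheta_doubling k b hb s hs
  have hpos : 0 ≤ Real.exp (-(s / 4 * K)) := (Real.exp_pos _).le
  have := mul_le_mul_of_nonneg_left hdoub hpos
  nlinarith [this, hsplit]

end Summit.QuantumFields.YangMills.Theorems.AnchorGap

end
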